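import Literature.MathematicalPhysics.QuantumFieldTheory.Balaban1983to89.B11Eq26ActionExpansion
import Literature.MathematicalPhysics.QuantumFieldTheory.Balaban1983to89.B16Sect1Statements

/-!
# `Balaban1983to89.B16Txt357ThirdOrderNonAbelian` — T. Bałaban, *Large field renormalization. II. Localization, exponentiation, and bounds for the 𝐑 operation*, Commun. Math. Phys. **122** (1989) 355–392 [Balaban1989LargeFieldII], Sect. 1 pp. 356–357: the expansion (1.2) of the LOCALIZED action `A(ζ₀, ·)` in the chart `V′ = exp ig_kB′` and the `V`-term — *"The last term in the exponential is small, because the function V is at least of third order in the argument. It can be estimated by O(g_k^{1−β})|Λ|"* — PROVED for the NON-ABELIAN model instance: any complete normed `ℂ`-algebra `𝔸` (`⊇ M_N(ℂ)`, hence `U(N)`, `SU(N)`), tracial functional `τ` ("tr"), exact background `U₀`, on the finite-lattice carrier of `B9Eq39Adjoint` / `B11Eq26ActionExpansion` (SKELETON row **B16.Txt@357**; so far the abelian `U(1)` instance `B16Txt357ThirdOrderU1`)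

statement-level skeleton of published theorems with citation tags; proofs where landed; nothing here is a claim about the Yang–Mills mass gap

PDF held: `paper:balaban1989-cmp122-large-field-ii` (journal page = PDF page + 354; pp. 356–357 = PDF pp. 2–3, renders
`run/shared/lean/pub/pub-balaban/b2b-balaban-ref1/pages/1989-cmp122-large-field-II/…-p002-x2.png`, `…-p003-x2.png` READ AS
IMAGES by this seat 2026-08-21).  P. 356, verbatim: *"Writing V′ = exp ig_kB′, identifying Λ with one of its components, and
using (2.8) [I], we get ∫dV′Γ_Λδ_{G₀}(V′)χ exp[−g_k⁻²A(ζ₀, U_{k,Z}(V′V_Λ))] = exp[−g_k⁻²A(ζ₀, U₀) + (−½d(𝔤)log g_k⁻² +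
log σ₀)|Λ^{(k)}∖G₀|]·∫dB′ Γ_Λσ(g_kB′)δ_{G₀}(B′)χ({|B′| < M₀g_k⁻¹ε_k})·exp[−½⟨H_{1,k}B′, Δ₁(ζ₀)H_{1,k}B′⟩ − g_k⁻¹⟨DH_{1,k}B′,
ζ₀η⁻² Im ∂U₀⟩ − g_k⁻²V(ζ₀, g_kH_{1,k}B′)]. (1.2)"*; p. 357: *"The last term in the exponential is small, because the function
V is at least of third order in the argument. It can be estimated by O(g_k^{1−β})|Λ|."*

WHAT IS REPRODUCED (mega-formalization `lit-balaban`, HOME `run/shared/lean/pub/lit-balaban/`, Phase-2 seat p26, generation 8;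
SKELETON row **B16.Txt@357** (r13), decl of record `B16Sect1Statements.Ineq12V (T C gk β volΛ) := |T| ≤ C·gk^{1−β}·volΛ`
(typed p243106), PROVED for the ABELIAN instance in `B16Txt357ThirdOrderU1` (r13 g6, p249579: the angles add, `V` = third
Taylor remainder of `1 − cos`); r13's `SURVEY-B16-remaining.md` §C: *"a U(N)/matrix instance needs the third-order remainder of
1 − Re tr(e^{iA}U) with non-commuting bond factors"*; referee ref-5).  THIS FILE is that non-abelian instance.  The
non-commutative third-order remainder is NOT re-developed: it is [5] = [Balaban1985BackgroundPropagators] (3.12) /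
[15] = [Balaban1985Variational] (26), (30), landed on the exact-background carrier `B9Eq39Adjoint` (lineage pv27) and
`B11Eq26ActionExpansion` (r08 g5) — per plaquette `B9Eq39Adjoint.summand_split` (the (3.7) summand = linear term +
½·quadratic terms + `η^{d−4}ρ_p`), `wil_plaqU_prodCfg`, and the third-order bound `norm_rem3_le`
(`‖ρ_p‖ ≦ ½‖τ‖(‖U₀(∂p)‖ + ‖U₀(∂p)⁻¹‖)·T₃(|η|Σ_b‖A′(b)‖)`, `T₃(t) = eᵗ − 1 − t − t²/2 ≦ (t³/6)eᵗ`) — used BY NAME and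
summed WITH THE WEIGHTS `ζ₀(p)` of the localized action.
  §1 the LOCALIZED objects (weights `ζ : S × ι × ι → ℝ`): `actionLoc` = `A(ζ₀, V) = Σ_p ζ₀(p)η^{d−4}[τ1 − τ Re V(∂p)]` (the
complexified reading of `B9Eq37Insertion.wil`), the linear form `linLoc` = `⟨DX, ζ₀η⁻² Im ∂U₀⟩` of (1.2)/(1.5), the quadratic
form `quadLoc` = `⟨X, Δ₁(ζ₀)X⟩` (the ζ₀-weighted (3.10) of [5]: `⟨X, D*DX⟩_ζ₀ + ⟨X, Δ′X⟩_ζ₀`), and THE `V`-TERM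
**`VLoc`** = `V(ζ₀, X) := Σ_p ζ₀(p)η^{d−4}ρ_p(X)`; `VLoc_eq_sum_V0p`: `V(ζ₀, X) = Σ_p ζ₀(p)η^d V₀(X, ∂p)` with [15] (30)'s
per-plaquette `B11Eq26ActionExpansion.V0p` (at `ζ₀ ≡ 1` this is [15]'s `V₀`, `VLoc_one`).  §2 **`actionLoc_prodCfg`** = (2.8)
[I] / (26) [15] LOCALIZED: `A(ζ₀, e^{iηX}U₀) = A(ζ₀, U₀) + ⟨DX, ζ₀η⁻²Im ∂U₀⟩ + ½⟨X, Δ₁(ζ₀)X⟩ + V(ζ₀, X)`; homogeneity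
`linLoc_smul`, `quadLoc_smul`; hence **`eq12_exponent`**: with `X = H_{1,k}B′` and the chart `exp ig_kX·U₀`,
`g⁻²A(ζ₀, e^{iηgX}U₀) = g⁻²A(ζ₀, U₀) + g⁻¹⟨DX, ζ₀η⁻²Im ∂U₀⟩ + ½⟨X, Δ₁(ζ₀)X⟩ + g⁻²V(ζ₀, gX)` — the exponent of (1.2) term by
term.  §3 *"at least of third order"*: **`norm_VLoc_le`** (`‖V(ζ₀, X)‖ ≦ Σ_p ζ₀(p)|η|^{d−4}·½‖τ‖(‖U₀(∂p)‖ + ‖U₀(∂p)⁻¹‖)·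
T₃(|η|s_p)`, `s_p = Σ_{b⊂∂p}‖X′(b)‖`), `size_lettersA_le` (`s_p ≦ 4Φ` when `‖X(b)‖ ≦ Φ` and `‖U₀(b)^{±1}‖ ≦ 1`),
**`norm_VLoc_smul_le`**: at `η = 1`, `‖V(ζ₀, gX)‖ ≦ 32‖τ‖·g³Φ³·Σ_pζ₀(p)` for `0 ≦ g`, `4gΦ ≦ 1`; §4 *"It can be estimated by
O(g_k^{1−β})|Λ|"* AS TYPED: **`ineq12V_nonAbelian`** = `Ineq12V (g⁻²‖V(ζ₀, gX)‖) (32‖τ‖K³c_βc_Λ) g β |Λ|` and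
`ineq12V_nonAbelian_re` (the real part, `T = g⁻² Re V`), under r13's printed bookkeeping — `‖X(b)‖ ≦ Φ ≦ K·p₀(g)` (the support
`|B′| < M₀g_k⁻¹ε_k`, `ε_k = g_kA₀p₀(g_k)`, `X = H_{1,k}B′` bounded), `4gΦ ≦ 1`, `p₀(g)³ ≦ c_βg^{−β}`, `Σ_pζ₀(p) ≦ c_Λ|Λ|`.

HONEST SCOPE / DEVIATIONS.  (1) MODEL INSTANCE on [5]'s abstract finite lattice (sites `S`, directions `ι`, bijective shifts
`T μ`, arbitrary units `U₀` — no unitarity except where `‖U₀(b)^{±1}‖ ≦ 1` is assumed for the constants), `Re tr` in the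
complexified reading `½[τ(Z·W) + τ(W⁻¹·Z̃)]` of [5] p. 391 as in `B9Eq39Adjoint`/`B11Eq26ActionExpansion` (DIVERGENCE D-pv27.4
inherited; for Hermitian `X`, unitary `U₀` and a `*`-trace these are the real parts — `B11Eq26ActionExpansion.eq26_printed` —
not re-threaded here: the bound is stated for `‖V‖` and for `Re V`).  (2) The identification of the chart variables: print's
argument of `V` is `g_kH_{1,k}B′`; here `X` is ANY bond field and `g` a real parameter (`X = H_{1,k}B′` is the reader's), the
lattice spacing `η` is kept in §§1–3 and set to `1` in the `g`-bookkeeping of §§3–4 (the unit lattice of the `k`-th step), `d ≧ 4`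
where [5] (3.12) is invoked (`η^{d−4}` a natural-number power).  (3) `Δ₁(ζ₀)` is NAMED here by its (3.10)-form with weights;
its identification with [13] (3.127)–(3.128) / [I] (2.7) (the `C^{(2)}`-correction, `⟨𝐀₁, Δ₁𝐀₁⟩`) is not claimed — for the
exact background `U₀` of (1.2) there is no `H_kD_k` correction in print either ((1.3)–(1.5) use `U₀` directly).  (4) The
constant `32‖τ‖K³c_βc_Λ` is this proof's (`(4gΦ)³/6·e^{4gΦ} ≦ 32g³Φ³`); print gives `O(·)`.  Every declaration is a
definition with a body or a proved theorem; nothing of [V] beyond this algebra is asserted.  Unit `lit-balaban-p26`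
(literature-prover-lit-balaban-p26-g8-0).
-/

noncomputable section

open NormedSpace Complex Finset
open scoped Nat

namespace Literature.MathematicalPhysics.QuantumFieldTheory.Balaban1983to89.B16Txt357ThirdOrderNonAbelian

open Literature.MathematicalPhysics.QuantumFieldTheory.Balaban1983to89.Beta.TransportVertices
open Literature.MathematicalPhysics.QuantumFieldTheory.Balaban1983to89.Beta.AdjointTransportJets
open Literature.MathematicalPhysics.QuantumFieldTheory.Balaban1983to89.B9Eq37Insertion
open Literature.MathematicalPhysics.QuantumFieldTheory.Balaban1983to89.B9Eq39Adjoint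
open B11Eq26ActionExpansion (V0p lettersA_smul)
open B16Sect1Statements (Ineq12V)

/-! ## §0 Elementary bookkeeping: transports, plaquette variables and letter sizes under `‖U₀(b)^{±1}‖ ≦ 1` -/

section Helpers

variable {𝔸 : Type*} [NormedRing 𝔸]

/-- Transport by a bond variable with `‖U‖, ‖U⁻¹‖ ≦ 1` does not increase norms: `‖R(U)Y‖ ≦ ‖Y‖`. [cite: Balaban1989LargeFieldII, (1.2) p.357] -/
theorem norm_R_le {V : 𝔸ˣ} (hV : ‖(V : 𝔸)‖ ≤ 1 ∧ ‖((V⁻¹ : 𝔸ˣ) : 𝔸)‖ ≤ 1) (Y : 𝔸) : ‖R V Y‖ ≤ ‖Y‖ := by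
  rw [R_def]
  have h1 : ‖(V : 𝔸) * Y‖ ≤ ‖Y‖ :=
    (norm_mul_le _ _).trans (by nlinarith [norm_nonneg Y, norm_nonneg (V : 𝔸), hV.1])
  exact (norm_mul_le _ _).trans (by nlinarith [norm_nonneg ((V : 𝔸) * Y), norm_nonneg ((V⁻¹ : 𝔸ˣ) : 𝔸), hV.2])

variable {S : Type*} {ι : Type*} (T : ι → Equiv.Perm S) (U : ι → S → 𝔸ˣ)

/-- The plaquette variable of a background with `‖U₀(b)^{±1}‖ ≦ 1` has `‖U₀(∂p)‖, ‖U₀(∂p)⁻¹‖ ≦ 1`. [cite: Balaban1989LargeFieldII, (1.2) p.357] -/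
theorem norm_plaqU_le (hU : ∀ μ x, ‖(U μ x : 𝔸)‖ ≤ 1 ∧ ‖(((U μ x)⁻¹ : 𝔸ˣ) : 𝔸)‖ ≤ 1) (μ ν : ι) (x : S) :
    ‖(plaqU T U μ ν x : 𝔸)‖ ≤ 1 ∧ ‖(((plaqU T U μ ν x)⁻¹ : 𝔸ˣ) : 𝔸)‖ ≤ 1 := by
  have hmul : ∀ a b : 𝔸, ‖a‖ ≤ 1 → ‖b‖ ≤ 1 → ‖a * b‖ ≤ 1 := fun a b ha hb =>
    (norm_mul_le a b).trans (by nlinarith [norm_nonneg a, norm_nonneg b])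
  constructor
  · simp only [plaqU, Units.val_mul]
    exact hmul _ _ (hmul _ _ (hmul _ _ (hU _ _).1 (hU _ _).1) (hU _ _).2) (hU _ _).2
  · simp only [plaqU, mul_inv_rev, inv_inv, Units.val_mul]
    exact hmul _ _ (hU _ _).1 (hmul _ _ (hU _ _).1 (hmul _ _ (hU _ _).2 (hU _ _).2))

/-- **The letters of one plaquette are bounded by the chart variable**: `Σ_{b⊂∂p}‖X′(b)‖ ≦ 4Φ` when `‖X(b)‖ ≦ Φ` on every bond and
`‖U₀(b)^{±1}‖ ≦ 1` (the transports `R(U₀(b))` of (3.2) [5] do not increase norms). [cite: Balaban1989LargeFieldII, (1.2) p.357] -/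
theorem size_lettersA_le (hU : ∀ μ x, ‖(U μ x : 𝔸)‖ ≤ 1 ∧ ‖(((U μ x)⁻¹ : 𝔸ˣ) : 𝔸)‖ ≤ 1) {X : ι → S → 𝔸} {Φ : ℝ}
    (hX : ∀ μ x, ‖X μ x‖ ≤ Φ) (μ ν : ι) (x : S) : size (lettersA T U X μ ν x) ≤ 4 * Φ := by
  simp only [lettersA, size_cons, size_nil, norm_neg]
  have h1 := (norm_R_le (hU ν x) (X μ (T ν x))).trans (hX μ (T ν x))
  have h4 := (norm_R_le (hU μ x) (X ν (T μ x))).trans (hX ν (T μ x))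
  linarith [hX ν x, hX μ x]

/-- The numerical step `(gs)³/6·e^{gs} ≦ 32g³Φ³` for `0 ≦ s ≦ 4Φ`, `0 ≦ 4gΦ ≦ 1` (`e ≦ 3`). [folklore] -/
private theorem expTail_three_le_32 {g Φ : ℝ} (hg : 0 ≤ g) (hΦ : 0 ≤ Φ) (hgΦ : 4 * g * Φ ≤ 1) {s : ℝ} (hs0 : 0 ≤ s)
    (hs : s ≤ 4 * Φ) : expTail 3 (|g| * s) ≤ 32 * g ^ 3 * Φ ^ 3 := by
  rw [abs_of_nonneg hg]
  have hgs : 0 ≤ g * s := mul_nonneg hg hs0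
  have hgs1 : g * s ≤ 4 * g * Φ := by nlinarith
  refine (expTail_three_le hgs).trans ?_
  have he : Real.exp (g * s) ≤ 3 :=
    (Real.exp_le_exp.mpr (hgs1.trans hgΦ)).trans (le_of_lt (lt_trans Real.exp_one_lt_d9 (by norm_num)))
  have hcube : (g * s) ^ 3 ≤ (4 * g * Φ) ^ 3 := pow_le_pow_left₀ hgs hgs1 3
  calc (g * s) ^ 3 / 6 * Real.exp (g * s) ≤ (4 * g * Φ) ^ 3 / 6 * 3 :=
        mul_le_mul (div_le_div_of_nonneg_right hcube (by norm_num)) he (Real.exp_nonneg _) (by positivity)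
    _ = 32 * g ^ 3 * Φ ^ 3 := by ring

end Helpers

variable {𝔸 : Type*} [NormedRing 𝔸] [NormedAlgebra ℂ 𝔸] [CompleteSpace 𝔸]
variable {S : Type*} [Fintype S] {ι : Type*} [Fintype ι] [LinearOrder ι]
variable (T : ι → Equiv.Perm S) (U : ι → S → 𝔸ˣ)

/-! ## §1 The localized action `A(ζ₀, ·)` and the four terms of its expansion -/

section Objects

/-- **The localized Wilson action `A(ζ₀, V) = Σ_p ζ₀(p)η^{d−4}[1 − Re tr V(∂p)]`** of [IV]/[V] ((1.1)–(1.2)), in the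
complexified reading of [5] p. 391 (`B9Eq37Insertion.wil τ W = τ1 − τ Re W`), weights `ζ₀(p)` on the positively oriented
plaquettes. [cite: Balaban1989LargeFieldII, (1.2) p.357] -/
def actionLoc (ζ : S × ι × ι → ℝ) (η : ℝ) (d : ℕ) (τ : 𝔸 →ₗ[ℂ] ℂ) (V : ι → S → 𝔸ˣ) : ℂ :=
  ∑ q ∈ posPlaq S ι, (ζ q : ℂ) * ((η : ℂ) ^ (d - 4) * wil τ (plaqU T V q.2.1 q.2.2 q.1))

omit [CompleteSpace 𝔸] in
/-- At `ζ₀ ≡ 1` the localized action is [5]'s `A^η` (`B9Eq39Adjoint.action`). [cite: Balaban1989LargeFieldII, (1.2) p.357] -/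
theorem actionLoc_one (η : ℝ) (d : ℕ) (τ : 𝔸 →ₗ[ℂ] ℂ) (V : ι → S → 𝔸ˣ) :
    actionLoc T (fun _ => 1) η d τ V = action T η d τ V := by
  simp [actionLoc, action]

/-- **The linear form of (1.2), `⟨DX, ζ₀η⁻² Im ∂U₀⟩`** `= Σ_p ζ₀(p)η^d τ((D^η_{U₀}X)(p)·η⁻² Im U₀(∂p))` (the ζ₀-weighted (3.11)
of [5]). [cite: Balaban1989LargeFieldII, (1.2) p.357] -/
def linLoc (ζ : S × ι × ι → ℝ) (η : ℝ) (d : ℕ) (τ : 𝔸 →ₗ[ℂ] ℂ) (X : ι → S → 𝔸) : ℂ :=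
  ∑ q ∈ posPlaq S ι, (ζ q : ℂ) *
    ((η : ℂ) ^ d * τ (curlη T U η X q.2.1 q.2.2 q.1 * ((((η : ℂ)⁻¹) ^ 2) • imC (plaqU T U q.2.1 q.2.2 q.1))))

/-- **The quadratic form of (1.2), `⟨X, Δ₁(ζ₀)X⟩`**, NAMED by the ζ₀-weighted (3.10) of [5]:
`Σ_p ζ₀(p)η^d[τ((D^ηX)(p)²) + τ((D¹X)(p)²·η⁻²(Re U₀(∂p) − 1)) + τ(iΣ_{b₁≺b₂}[X′(b₁), X′(b₂)]·η⁻² Im U₀(∂p))]`.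
[cite: Balaban1989LargeFieldII, (1.2) p.357] -/
def quadLoc (ζ : S × ι × ι → ℝ) (η : ℝ) (d : ℕ) (τ : 𝔸 →ₗ[ℂ] ℂ) (X : ι → S → 𝔸) : ℂ :=
  ∑ q ∈ posPlaq S ι, (ζ q : ℂ) *
    ((η : ℂ) ^ d * τ (curlη T U η X q.2.1 q.2.2 q.1 * curlη T U η X q.2.1 q.2.2 q.1)
      + (η : ℂ) ^ d * (τ (curl T U X q.2.1 q.2.2 q.1 * curl T U X q.2.1 q.2.2 q.1
          * ((((η : ℂ)⁻¹) ^ 2) • (reC (plaqU T U q.2.1 q.2.2 q.1) - 1)))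
        + τ ((I • commSum (lettersA T U X q.2.1 q.2.2 q.1)) * ((((η : ℂ)⁻¹) ^ 2) • imC (plaqU T U q.2.1 q.2.2 q.1)))))

/-- **THE `V`-TERM OF (1.2), `V(ζ₀, X) := Σ_p ζ₀(p)η^{d−4}ρ_p(X)`** — the ζ₀-weighted sum of [5]'s per-plaquette third-order
remainders `ρ_p = B9Eq39Adjoint.rem3` (the terms of order `≧ 3` of `1 − Re tr(Π_b e^{iηX′(b)}·U₀(∂p))`, non-commuting bond
factors included). [cite: Balaban1989LargeFieldII, (1.2) p.357] -/
def VLoc (ζ : S × ι × ι → ℝ) (η : ℝ) (d : ℕ) (τ : 𝔸 →ₗ[ℂ] ℂ) (X : ι → S → 𝔸) : ℂ :=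
  ∑ q ∈ posPlaq S ι, (ζ q : ℂ) * ((η : ℂ) ^ (d - 4) * rem3 T U η τ X q.2.1 q.2.2 q.1)

omit [CompleteSpace 𝔸] in
/-- **Dictionary to [15] (30)**: `V(ζ₀, X) = Σ_p ζ₀(p)η^d V₀(X, ∂p)` with the per-plaquette `V₀(X, ∂p) = η⁻⁴ρ_p` of
`B11Eq26ActionExpansion` (`η ≠ 0`, `d ≧ 4`). [cite: Balaban1989LargeFieldII, (1.2) p.357] -/
theorem VLoc_eq_sum_V0p (ζ : S × ι × ι → ℝ) (η : ℝ) (hη : η ≠ 0) {d : ℕ} (hd : 4 ≤ d) (τ : 𝔸 →ₗ[ℂ] ℂ)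
    (X : ι → S → 𝔸) :
    VLoc T U ζ η d τ X = ∑ q ∈ posPlaq S ι, (ζ q : ℂ) * ((η : ℂ) ^ d * V0p T U η τ X q.2.1 q.2.2 q.1) := by
  unfold VLoc V0p
  refine Finset.sum_congr rfl fun q _ => ?_
  have hη' : (η : ℂ) ≠ 0 := Complex.ofReal_ne_zero.mpr hη
  obtain ⟨k, rfl⟩ := Nat.exists_eq_add_of_le hd
  rw [Nat.add_sub_cancel_left, pow_add]
  field_simp

/-- At `ζ₀ ≡ 1` the `V`-term is [15]'s `V₀` (`B11Eq26ActionExpansion.V0`, via (26) = [5] (3.12)). [cite: Balaban1989LargeFieldII, (1.2) p.357] -/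
theorem VLoc_one (τ : 𝔸 →ₗ[ℂ] ℂ) (hτ : ∀ a b : 𝔸, τ (a * b) = τ (b * a)) (η : ℝ) (hη : η ≠ 0) {d : ℕ} (hd : 4 ≤ d)
    (X : ι → S → 𝔸) : VLoc T U (fun _ => 1) η d τ X = B11Eq26ActionExpansion.V0 T U η d τ X := by
  have h26 := B11Eq26ActionExpansion.eq26 T U η d τ X
  have h312 := eq312 T U τ hτ η hη hd X
  have hV : B11Eq26ActionExpansion.V0 T U η d τ X
      = (η : ℂ) ^ (d - 4) * ∑ q ∈ posPlaq S ι, rem3 T U η τ X q.2.1 q.2.2 q.1 := by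
    have := h26.symm.trans h312
    -- both sides: action U + bondPair + ½ hess + (…)
    linear_combination this
  rw [hV, VLoc, Finset.mul_sum]
  simp

end Objects

/-! ## §2 The localized expansion (2.8) [I] / (26) [15] and the exponent of (1.2) -/

section Expansion

/-- **THE LOCALIZED EXPANSION** ((2.8) [I] *"A(U_k(V′V^{(k)})) = A(U_{k+1}) + ⟨H₁B′, J⟩ + ½⟨H₁B′, Δ₁H₁B′⟩ + V(H₁B′)"* with the
weights `ζ₀(p)` of [IV]/[V]; exact background as in (1.2)): `A(ζ₀, e^{iηX}U₀) = A(ζ₀, U₀) + ⟨DX, ζ₀η⁻² Im ∂U₀⟩ +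
½⟨X, Δ₁(ζ₀)X⟩ + V(ζ₀, X)` — [5]'s per-plaquette (3.7)-split `B9Eq39Adjoint.summand_split` summed with the weights (tracial
`τ`, `η ≠ 0`, `d ≧ 4`). [cite: Balaban1989LargeFieldII, (1.2) p.357] -/
theorem actionLoc_prodCfg (τ : 𝔸 →ₗ[ℂ] ℂ) (hτ : ∀ a b : 𝔸, τ (a * b) = τ (b * a)) (η : ℝ) (hη : η ≠ 0) {d : ℕ}
    (hd : 4 ≤ d) (ζ : S × ι × ι → ℝ) (X : ι → S → 𝔸) :
    actionLoc T ζ η d τ (prodCfg U η X)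
      = actionLoc T ζ η d τ U + linLoc T U ζ η d τ X + 2⁻¹ * quadLoc T U ζ η d τ X + VLoc T U ζ η d τ X := by
  unfold actionLoc linLoc quadLoc VLoc
  rw [Finset.mul_sum, ← Finset.sum_add_distrib, ← Finset.sum_add_distrib, ← Finset.sum_add_distrib]
  refine Finset.sum_congr rfl fun q _ => ?_
  have h := summand_split T U τ hτ η hη hd X q.2.1 q.2.2 q.1
  rw [← wil_plaqU_prodCfg T U τ hτ η X q.2.1 q.2.2 q.1, mul_sub, sub_eq_iff_eq_add] at h
  rw [h]
  ring

omit [CompleteSpace 𝔸] [Fintype S] [Fintype ι] [LinearOrder ι] in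
/-- `(D^η(cX))(p) = c·(D^ηX)(p)`. [cite: Balaban1989LargeFieldII, (1.2) p.357] -/
theorem curlη_smul (η : ℝ) (c : ℂ) (X : ι → S → 𝔸) (μ ν : ι) (x : S) :
    curlη T U η (c • X) μ ν x = c • curlη T U η X μ ν x := by
  rw [curlη, curlη, curl_smul, smul_comm]

omit [CompleteSpace 𝔸] in
/-- The linear form is linear in the chart variable: `⟨D(cX), ζ₀η⁻² Im ∂U₀⟩ = c·⟨DX, ζ₀η⁻² Im ∂U₀⟩`. [cite: Balaban1989LargeFieldII, (1.2) p.357] -/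
theorem linLoc_smul (ζ : S × ι × ι → ℝ) (η : ℝ) (d : ℕ) (τ : 𝔸 →ₗ[ℂ] ℂ) (c : ℂ) (X : ι → S → 𝔸) :
    linLoc T U ζ η d τ (c • X) = c * linLoc T U ζ η d τ X := by
  unfold linLoc
  rw [Finset.mul_sum]
  refine Finset.sum_congr rfl fun q _ => ?_
  rw [curlη_smul, smul_mul_assoc, map_smul, smul_eq_mul]
  ring

omit [CompleteSpace 𝔸] in
/-- The quadratic form is quadratic in the chart variable: `⟨cX, Δ₁(ζ₀)(cX)⟩ = c²·⟨X, Δ₁(ζ₀)X⟩` (the commutator sum scales by `c²`: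
`Beta.TransportVertices.commSum_map_smul`). [cite: Balaban1989LargeFieldII, (1.2) p.357] -/
theorem quadLoc_smul (ζ : S × ι × ι → ℝ) (η : ℝ) (d : ℕ) (τ : 𝔸 →ₗ[ℂ] ℂ) (c : ℂ) (X : ι → S → 𝔸) :
    quadLoc T U ζ η d τ (c • X) = c ^ 2 * quadLoc T U ζ η d τ X := by
  unfold quadLoc
  rw [Finset.mul_sum]
  refine Finset.sum_congr rfl fun q _ => ?_
  rw [curlη_smul, curl_smul, lettersA_smul, commSum_map_smul]
  simp only [smul_mul_assoc, mul_smul_comm, map_smul, smul_eq_mul, smul_smul]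
  ring

/-- **THE EXPONENT OF (1.2), TERM BY TERM** (non-abelian model instance): for a real `g ≠ 0` and the chart `exp ig·X·U₀`
(`X = H_{1,k}B′` in print), `g⁻²A(ζ₀, e^{iηgX}U₀) = g⁻²A(ζ₀, U₀) + g⁻¹⟨DX, ζ₀η⁻² Im ∂U₀⟩ + ½⟨X, Δ₁(ζ₀)X⟩ + g⁻²V(ζ₀, gX)` —
print: *"exp[−g_k⁻²A(ζ₀, U₀) …]·… exp[−½⟨H_{1,k}B′, Δ₁(ζ₀)H_{1,k}B′⟩ − g_k⁻¹⟨DH_{1,k}B′, ζ₀η⁻² Im ∂U₀⟩ − g_k⁻²V(ζ₀, g_kH_{1,k}B′)]"*.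
[cite: Balaban1989LargeFieldII, (1.2) p.357] -/
theorem eq12_exponent (τ : 𝔸 →ₗ[ℂ] ℂ) (hτ : ∀ a b : 𝔸, τ (a * b) = τ (b * a)) (η : ℝ) (hη : η ≠ 0) {d : ℕ}
    (hd : 4 ≤ d) (ζ : S × ι × ι → ℝ) {g : ℝ} (hg : g ≠ 0) (X : ι → S → 𝔸) :
    ((g : ℂ) ^ 2)⁻¹ * actionLoc T ζ η d τ (prodCfg U η ((g : ℂ) • X))
      = ((g : ℂ) ^ 2)⁻¹ * actionLoc T ζ η d τ U + ((g : ℂ))⁻¹ * linLoc T U ζ η d τ X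
        + 2⁻¹ * quadLoc T U ζ η d τ X + ((g : ℂ) ^ 2)⁻¹ * VLoc T U ζ η d τ ((g : ℂ) • X) := by
  have hg' : (g : ℂ) ≠ 0 := Complex.ofReal_ne_zero.mpr hg
  rw [actionLoc_prodCfg T U τ hτ η hη hd ζ, linLoc_smul, quadLoc_smul]
  field_simp

end Expansion

/-! ## §3 "The function V is at least of third order in the argument" -/

section ThirdOrder

/-- **`V(ζ₀, ·)` is of third order**, per plaquette summed with the weights `ζ₀(p) ≧ 0`:
`‖V(ζ₀, X)‖ ≦ Σ_p ζ₀(p)|η|^{d−4}·½‖τ‖(‖U₀(∂p)‖ + ‖U₀(∂p)⁻¹‖)·T₃(|η|Σ_{b⊂∂p}‖X′(b)‖)`, `T₃(t) = eᵗ − 1 − t − t²/2`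
(`B9Eq39Adjoint.norm_rem3_le` BY NAME). [cite: Balaban1989LargeFieldII, (1.2) p.357] -/
theorem norm_VLoc_le (τ : 𝔸 →L[ℂ] ℂ) {ζ : S × ι × ι → ℝ} (hζ : ∀ q, 0 ≤ ζ q) (η : ℝ) (d : ℕ) (X : ι → S → 𝔸) :
    ‖VLoc T U ζ η d (τ : 𝔸 →ₗ[ℂ] ℂ) X‖
      ≤ ∑ q ∈ posPlaq S ι, ζ q * (|η| ^ (d - 4) *
          (2⁻¹ * ‖τ‖ * (‖(plaqU T U q.2.1 q.2.2 q.1 : 𝔸)‖ + ‖(((plaqU T U q.2.1 q.2.2 q.1)⁻¹ : 𝔸ˣ) : 𝔸)‖)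
            * expTail 3 (|η| * size (lettersA T U X q.2.1 q.2.2 q.1)))) := by
  unfold VLoc
  refine (norm_sum_le _ _).trans (Finset.sum_le_sum fun q _ => ?_)
  rw [norm_mul, norm_mul, norm_pow, Complex.norm_real, Complex.norm_real, Real.norm_eq_abs, Real.norm_eq_abs,
    abs_of_nonneg (hζ q)]
  exact mul_le_mul_of_nonneg_left (mul_le_mul_of_nonneg_left (norm_rem3_le T U τ η X q.2.1 q.2.2 q.1)
    (by positivity)) (hζ q)

/-- **The `V`-term in the chart `exp ig·X·U₀` is `O(g³)`** (unit lattice `η = 1`): for weights `0 ≦ ζ₀`, a background with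
`‖U₀(b)^{±1}‖ ≦ 1`, `‖X(b)‖ ≦ Φ` and `0 ≦ g`, `4gΦ ≦ 1`: `‖V(ζ₀, gX)‖ ≦ 32‖τ‖·g³Φ³·Σ_pζ₀(p)` — two powers of `g` cancel the
`g⁻²` of (1.2), one is left. [cite: Balaban1989LargeFieldII, (1.2) p.357] -/
theorem norm_VLoc_smul_le (τ : 𝔸 →L[ℂ] ℂ) {ζ : S × ι × ι → ℝ} (hζ : ∀ q, 0 ≤ ζ q)
    (hU : ∀ μ x, ‖(U μ x : 𝔸)‖ ≤ 1 ∧ ‖(((U μ x)⁻¹ : 𝔸ˣ) : 𝔸)‖ ≤ 1) {X : ι → S → 𝔸} {Φ g : ℝ}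
    (hX : ∀ μ x, ‖X μ x‖ ≤ Φ) (hΦ : 0 ≤ Φ) (hg : 0 ≤ g) (hgΦ : 4 * g * Φ ≤ 1) (d : ℕ) :
    ‖VLoc T U ζ 1 d (τ : 𝔸 →ₗ[ℂ] ℂ) ((g : ℂ) • X)‖ ≤ 32 * ‖τ‖ * g ^ 3 * Φ ^ 3 * ∑ q ∈ posPlaq S ι, ζ q := by
  refine (norm_VLoc_le T U τ hζ 1 d _).trans ?_
  rw [Finset.mul_sum]
  refine Finset.sum_le_sum fun q _ => ?_
  simp only [abs_one, one_pow, one_mul]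
  obtain ⟨hW, hWi⟩ := norm_plaqU_le T U hU q.2.1 q.2.2 q.1
  have hsize : size (lettersA T U ((g : ℂ) • X) q.2.1 q.2.2 q.1) = |g| * size (lettersA T U X q.2.1 q.2.2 q.1) := by
    rw [lettersA_smul, size_map_smul, Complex.norm_real, Real.norm_eq_abs]
  have hT : expTail 3 (size (lettersA T U ((g : ℂ) • X) q.2.1 q.2.2 q.1)) ≤ 32 * g ^ 3 * Φ ^ 3 := by
    rw [hsize]
    exact expTail_three_le_32 hg hΦ hgΦ (size_nonneg _) (size_lettersA_le T U hU hX _ _ _)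
  have hfac : 2⁻¹ * ‖τ‖ * (‖(plaqU T U q.2.1 q.2.2 q.1 : 𝔸)‖ + ‖(((plaqU T U q.2.1 q.2.2 q.1)⁻¹ : 𝔸ˣ) : 𝔸)‖) ≤ ‖τ‖ := by
    nlinarith [norm_nonneg τ]
  have hT0 : 0 ≤ expTail 3 (size (lettersA T U ((g : ℂ) • X) q.2.1 q.2.2 q.1)) := expTail_nonneg 3 (size_nonneg _)
  calc ζ q * (2⁻¹ * ‖τ‖ * (‖(plaqU T U q.2.1 q.2.2 q.1 : 𝔸)‖ + ‖(((plaqU T U q.2.1 q.2.2 q.1)⁻¹ : 𝔸ˣ) : 𝔸)‖)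
        * expTail 3 (size (lettersA T U ((g : ℂ) • X) q.2.1 q.2.2 q.1)))
      ≤ ζ q * (‖τ‖ * (32 * g ^ 3 * Φ ^ 3)) :=
        mul_le_mul_of_nonneg_left (mul_le_mul hfac hT hT0 (norm_nonneg _)) (hζ q)
    _ = 32 * ‖τ‖ * g ^ 3 * Φ ^ 3 * ζ q := by ring

end ThirdOrder

/-! ## §4 "It can be estimated by O(g_k^{1−β})|Λ|" — row B16.Txt@357 AS TYPED, non-abelian instance -/

section Printed

/-- **Row B16.Txt@357 PROVED for the non-abelian model instance, AS TYPED** (`B16Sect1Statements.Ineq12V`): on the unit lattice,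
for a tracial bounded `τ` ("tr"), weights `0 ≦ ζ₀` with `Σ_pζ₀(p) ≦ c_Λ|Λ|` (the plaquettes of `Λ`), a background with
`‖U₀(b)^{±1}‖ ≦ 1` (unitary), the chart variable `X` (`= H_{1,k}B′`) with `‖X(b)‖ ≦ Φ ≦ K·p₀(g)` (the support `|B′| < M₀g⁻¹ε_k`,
`ε_k = gA₀p₀(g)`), `4gΦ ≦ 1` (`g` small) and `p₀(g)³ ≦ c_βg^{−β}`: the `V`-term of (1.2) obeys
`g⁻²‖V(ζ₀, gX)‖ ≦ 32‖τ‖K³c_βc_Λ·g^{1−β}·|Λ|` — *"It can be estimated by O(g_k^{1−β})|Λ|"* with the `O(·)` explicit.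
[cite: Balaban1989LargeFieldII, (1.2) p.357] -/
theorem ineq12V_nonAbelian (τ : 𝔸 →L[ℂ] ℂ) {ζ : S × ι × ι → ℝ} (hζ : ∀ q, 0 ≤ ζ q)
    (hU : ∀ μ x, ‖(U μ x : 𝔸)‖ ≤ 1 ∧ ‖(((U μ x)⁻¹ : 𝔸ˣ) : 𝔸)‖ ≤ 1) {X : ι → S → 𝔸}
    {g Φ K p₀g cβ β cΛ volΛ : ℝ} (hg : 0 < g) (hX : ∀ μ x, ‖X μ x‖ ≤ Φ) (hΦ : 0 ≤ Φ) (hgΦ : 4 * g * Φ ≤ 1)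
    (hK : Φ ≤ K * p₀g) (hK0 : 0 ≤ K) (hp0 : 0 ≤ p₀g) (hp : p₀g ^ 3 ≤ cβ * g ^ (-β))
    (hcard : ∑ q ∈ posPlaq S ι, ζ q ≤ cΛ * volΛ) (d : ℕ) :
    Ineq12V (1 / g ^ 2 * ‖VLoc T U ζ 1 d (τ : 𝔸 →ₗ[ℂ] ℂ) ((g : ℂ) • X)‖) (32 * ‖τ‖ * K ^ 3 * cβ * cΛ) g β volΛ := by
  unfold Ineq12V
  have h1 := norm_VLoc_smul_le T U τ hζ hU hX hΦ hg.le hgΦ d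
  have hsum0 : 0 ≤ ∑ q ∈ posPlaq S ι, ζ q := Finset.sum_nonneg fun q _ => hζ q
  have hΦ3 : Φ ^ 3 ≤ (K * p₀g) ^ 3 := pow_le_pow_left₀ hΦ hK 3
  have hgβ : 0 < g ^ (-β) := Real.rpow_pos_of_pos hg _
  have hcβ0 : 0 ≤ cβ := by
    have : 0 ≤ cβ * g ^ (-β) := (pow_nonneg hp0 3).trans hp
    by_contra hneg
    have : cβ * g ^ (-β) < 0 := mul_neg_of_neg_of_pos (not_le.mp hneg) hgβ
    linarith
  have h2 : Φ ^ 3 ≤ K ^ 3 * (cβ * g ^ (-β)) := by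
    calc Φ ^ 3 ≤ (K * p₀g) ^ 3 := hΦ3
      _ = K ^ 3 * p₀g ^ 3 := by ring
      _ ≤ K ^ 3 * (cβ * g ^ (-β)) := mul_le_mul_of_nonneg_left hp (by positivity)
  have hrpow : g ^ (1 - β) = g * g ^ (-β) := by
    rw [sub_eq_add_neg, Real.rpow_add hg, Real.rpow_one]
  have hcΛ : 0 ≤ cΛ * volΛ := hsum0.trans hcard
  rw [abs_of_nonneg (by positivity)]
  calc 1 / g ^ 2 * ‖VLoc T U ζ 1 d (τ : 𝔸 →ₗ[ℂ] ℂ) ((g : ℂ) • X)‖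
      ≤ 1 / g ^ 2 * (32 * ‖τ‖ * g ^ 3 * Φ ^ 3 * ∑ q ∈ posPlaq S ι, ζ q) :=
        mul_le_mul_of_nonneg_left h1 (by positivity)
    _ = 32 * ‖τ‖ * g * Φ ^ 3 * ∑ q ∈ posPlaq S ι, ζ q := by field_simp
    _ ≤ 32 * ‖τ‖ * g * (K ^ 3 * (cβ * g ^ (-β))) * (cΛ * volΛ) := by
        gcongr
    _ = 32 * ‖τ‖ * K ^ 3 * cβ * cΛ * g ^ (1 - β) * volΛ := by rw [hrpow]; ring

/-- The same for the REAL PART `T = g⁻² Re V(ζ₀, gX)` (`|Re z| ≦ ‖z‖`; for Hermitian data the `V`-term is real).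
[cite: Balaban1989LargeFieldII, (1.2) p.357] -/
theorem ineq12V_nonAbelian_re (τ : 𝔸 →L[ℂ] ℂ) {ζ : S × ι × ι → ℝ} (hζ : ∀ q, 0 ≤ ζ q)
    (hU : ∀ μ x, ‖(U μ x : 𝔸)‖ ≤ 1 ∧ ‖(((U μ x)⁻¹ : 𝔸ˣ) : 𝔸)‖ ≤ 1) {X : ι → S → 𝔸}
    {g Φ K p₀g cβ β cΛ volΛ : ℝ} (hg : 0 < g) (hX : ∀ μ x, ‖X μ x‖ ≤ Φ) (hΦ : 0 ≤ Φ) (hgΦ : 4 * g * Φ ≤ 1)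
    (hK : Φ ≤ K * p₀g) (hK0 : 0 ≤ K) (hp0 : 0 ≤ p₀g) (hp : p₀g ^ 3 ≤ cβ * g ^ (-β))
    (hcard : ∑ q ∈ posPlaq S ι, ζ q ≤ cΛ * volΛ) (d : ℕ) :
    Ineq12V (1 / g ^ 2 * (VLoc T U ζ 1 d (τ : 𝔸 →ₗ[ℂ] ℂ) ((g : ℂ) • X)).re) (32 * ‖τ‖ * K ^ 3 * cβ * cΛ) g β volΛ := by
  have h := ineq12V_nonAbelian T U τ hζ hU hg hX hΦ hgΦ hK hK0 hp0 hp hcard d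
  unfold Ineq12V at h ⊢
  refine le_trans ?_ h
  rw [abs_mul, abs_mul, abs_norm]
  exact mul_le_mul_of_nonneg_left (Complex.abs_re_le_norm _) (abs_nonneg _)

end Printed

end Literature.MathematicalPhysics.QuantumFieldTheory.Balaban1983to89.B16Txt357ThirdOrderNonAbelian
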